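import Summits.ResolutionOfSingularities.ResolutionOfSingularities.Theorems.PAlterationPialtAtomsOpenRange
import Literature.AlgebraicGeometry.Resolution.ProperModelsPatchingOfResolution
import Literature.AlgebraicGeometry.Resolution.ProperModelsJoin
import Literature.AlgebraicGeometry.Resolution.ResolutionOfSingularities
import HarnessLib

/-!
# Stub `stub_twoModelPatchingAt_of_trdeg_le_three` (crux stmt-ResolutionOfSingularities-0552, line `Sketch` rev. c7)

Certification stub of the skeleton `Sketch` (rev. c7) for the crux `PalterationThesis`
(stmt-ResolutionOfSingularities-0552): the second perfect-field residue `TMP_K` — Piltant's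
two-model patching of proper models of a function field `F/K` (any two proper models are
dominated by a third that is `RegLe` over both) — is a theorem in transcendence degree `≤ 3`
over every field `K` of characteristic `p`, modulo the named fact `CossartPiltant2019`
(Cossart–Piltant 2019, Thm. 1.1: resolution of reduced separated schemes of finite type of
dimension `≤ 3` over a field). Twin of `stub_regModelAt_of_trdeg_le_three` (lead c6) for the
first residue `RegModel_K`: both residues of rev. c6/c7 are open exactly from transcendence
degree `4`.

Proof: the join `M₁ ⋈ M₂` (`ProperModel.join`, the closure of the diagonal `F`-point in
`M₁ ×_K M₂`) is a proper model of `F/K`, so `dim (M₁ ⋈ M₂).X = trdeg_K F = d ≤ 3`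
(`properModel_topologicalKrullDim_eq_of_trdeg`); `hasResolution_of_dim_le_three` resolves it; a
resolution of a proper model is a REGULAR proper model dominating it
(`ProperModel.exists_hom_isRegular_of_hasResolution`); compose with the two projections of the
join; a regular model is `RegLe` over every model it dominates. This is the fieldwise,
dimension-restricted form of `ProperModel.twoModelPatching_of_resolutionInChar`.
-/

set_option linter.dupNamespace false

noncomputable section

open CategoryTheory AlgebraicGeometry
open Literature.AlgebraicGeometry.Resolution
open Summit.ResolutionOfSingularities.ResolutionOfSingularities.Theorems.Pialt.OpenRange
  (properModel_topologicalKrullDim_eq_of_trdeg)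

namespace Summit.ResolutionOfSingularities.ResolutionOfSingularities.Theorems.PalterationThesis.ZariskiPerfect

/-- CERTIFICATION STUB (worker-sized, rev. c7): the residue `TMP_K` in transcendence degree
`≤ 3` over every field `K` of characteristic `p`, modulo the named fact `CossartPiltant2019`
(Cossart–Piltant 2019, Thm. 1.1): resolve the join `M₁ ⋈ M₂`, of dimension `trdeg_K F ≤ 3`, by
`hasResolution_of_dim_le_three`; a resolution of a proper model is a regular proper model
dominating it, and a regular model is `RegLe` over every model it dominates. So the second
residue, like the first (`stub_regModelAt_of_trdeg_le_three`, c6), is open exactly from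
transcendence degree `4`. [cite: CossartPiltant2019, Thm. 1.1] -/
theorem stub_twoModelPatchingAt_of_trdeg_le_three (hCP : CossartPiltant2019.{0}) {p : ℕ}
    (K : Type) [Field K] [CharP K p] (F : Type) [Field F] [Algebra K F]
    [Algebra.EssFiniteType K F] (d : ℕ) (hd : d ≤ 3) (htr : Algebra.trdeg K F = d)
    (M₁ M₂ : ProperModel K F) :
    ∃ (N : ProperModel K F) (φ₁ : N.Hom M₁) (φ₂ : N.Hom M₂), φ₁.RegLe ∧ φ₂.RegLe := by
  -- the join is a proper model, of dimension `trdeg_K F = d ≤ 3`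
  have hdim : topologicalKrullDim (ProperModel.join M₁ M₂).X ≤ 3 := by
    rw [properModel_topologicalKrullDim_eq_of_trdeg (ProperModel.join M₁ M₂) htr]
    exact_mod_cast hd
  -- resolve the join; a resolution of a proper model is a regular proper model dominating it
  obtain ⟨N, φ, hN⟩ := ProperModel.exists_hom_isRegular_of_hasResolution (ProperModel.join M₁ M₂)
    (hasResolution_of_dim_le_three (p := p) hCP K (ProperModel.join M₁ M₂).X
      (ProperModel.join M₁ M₂).π hdim)
  -- a regular model is `RegLe` over both models it dominates
  exact ⟨N, φ.comp (ProperModel.joinFst M₁ M₂), φ.comp (ProperModel.joinSnd M₁ M₂),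
    fun y _ => hN y, fun y _ => hN y⟩

end Summit.ResolutionOfSingularities.ResolutionOfSingularities.Theorems.PalterationThesis.ZariskiPerfect

end
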